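import Summits.AtomisticToContinuum.Crystallization.Theorems.HullExactificationCascadeRobustBarlowTemplateTransportDefs
import Summits.AtomisticToContinuum.Crystallization.Theorems.HullExactificationCascadeRobustBarlowTemplateDevelopCharts
import Summits.AtomisticToContinuum.Crystallization.Theorems.HullExactificationCascadeRobustBarlowTemplateStubReciprocity
import Summits.AtomisticToContinuum.Crystallization.Theorems.PalmUnimodularRigidityShellsToBarlowChartDevelopCovering

/-!
# `develop_covering` for line `registered` (crux `RobustBarlowTemplate`, stmt-AtomisticToContinuum-12088)

The ALGEBRAIC half of developing the ideal Barlow stacking into `S`: a (shell) transport system on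
`S` — an abstract frame type `F` with a point map `pt`, three commuting permutations `I, J, V`, an
`I, J`-invariant parity `par = ±1` and a base frame `f₀`, whose STAR clause maps the twelve frames
`V^r (J^(−Q) (I^(−P) f))`, `(r, P, Q) ∈ linkOffsets (par (V⁻¹ f)) (par f)`, bijectively onto
`shell S (pt f)` and whose LINK clause reads shell-adjacency among them as `linkAdj` — yields the
Hägg word `s k := par (V^k f₀)` and the shell covering
`Ψ (barlowPos 1 √(2/3) s k i j) := pt (V^k (J^j (I^i f₀)))` of `S` by `idealStacking s`.

This is a port of the closed sibling stub
`PalmUnimodularRigidityShellsToBarlowChart.stub_developCovering` (stmt-9227) to the scale-relative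
shell relation: the bond window `(0, 28/25]` is replaced by `y ∈ shell S x`, there is no
reachability clause and correspondingly no surjectivity conjunct in `IsShellCovering`.  The frame
algebra (`frame_shift`, `par_frame`, `inv_apply_zpow_apply`), the injectivity of the site
parametrisation (`barlowPos_triple_injective`) and the description of the model contacts in
relative coordinates (`contacts_barlowPos_eq_image`) are imported from the 9227 file.

Contents:
* `covering_isShellCovering_of_frames` — bookkeeping: frames of the sites with the shift rule and
  the parity rules turn STAR + LINK into `IsShellCovering`;
* `develop_covering` — the stub.
-/

noncomputable section

namespace Summit.AtomisticToContinuum.Crystallization.Theorems.HullExactificationCascadeRobustBarlowTemplate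

open Literature.MathematicalPhysics.StatisticalMechanics Literature.Geometry.DiscreteGeometry
open Summit.AtomisticToContinuum.Crystallization.Theorems.PalmUnimodularRigidityShellsToBarlowChart
  (contacts fcc3Int)
open RealInnerProductSpace
open Summit.AtomisticToContinuum.Crystallization.Theorems.PalmUnimodularRigidityShellsToBarlowChart.DevelopCovering
open Summit.AtomisticToContinuum.Crystallization.Theorems.ShellsToBarlowChartNegative
  (sqrt_two_thirds_sq)

/-- Euclidean `3`-space. -/
local notation "E3" => EuclideanSpace ℝ (Fin 3)

/-- **Bookkeeping** (shell version of the 9227 `isBondCovering_of_frames`): frames `fr (k, i, j)`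
of the sites with the shift rule `V^r (J^(−Q) (I^(−P) (fr (k,i,j)))) = fr (k + r, i − P, j − Q)`,
parities `par (fr (k,i,j)) = s k`, `par (V⁻¹ (fr (k,i,j))) = s (k−1)`, and a map `Ψ` into `S` with
`Ψ (barlowPos 1 √(2/3) s k i j) = pt (fr (k,i,j))` turn STAR + LINK of the shell transport system
into a shell covering: star-bijective by STAR read through `contacts_barlowPos_eq_image`
(`touching_iff_exists_linkOffsets`), link-faithful by LINK and `dist_relPos_eq_iff_linkAdj`.
[folklore] -/
theorem covering_isShellCovering_of_frames {S : Set E3} {F : Type*} {pt : F → E3}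
    {I J V : Equiv.Perm F} {par : F → ℤ} {s : ℤ → ℤ} {fr : ℤ × ℤ × ℤ → F} {Ψ : E3 → E3}
    (hs : IsHaggSeq s)
    (hstar : ∀ f,
      Set.BijOn (fun x : ℤ × ℤ × ℤ => pt ((V ^ x.1) ((J ^ (-x.2.2)) ((I ^ (-x.2.1)) f))))
        (↑(linkOffsets (par (V⁻¹ f)) (par f)) : Set (ℤ × ℤ × ℤ)) (shell S (pt f)))
    (hlink : ∀ f, ∀ x ∈ linkOffsets (par (V⁻¹ f)) (par f), ∀ y ∈ linkOffsets (par (V⁻¹ f)) (par f),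
        (pt ((V ^ y.1) ((J ^ (-y.2.2)) ((I ^ (-y.2.1)) f))) ∈
            shell S (pt ((V ^ x.1) ((J ^ (-x.2.2)) ((I ^ (-x.2.1)) f)))) ↔
          linkAdj (par (V⁻¹ f)) (par f) x y))
    (hΨ : ∀ k i j, Ψ (barlowPos 1 (Real.sqrt (2 / 3)) s k i j) = pt (fr (k, i, j)))
    (hΨS : ∀ q, Ψ q ∈ S)
    (hshift : ∀ k i j (x : ℤ × ℤ × ℤ), (V ^ x.1) ((J ^ (-x.2.2)) ((I ^ (-x.2.1)) (fr (k, i, j)))) =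
      fr (k + x.1, i - x.2.1, j - x.2.2))
    (hpar0 : ∀ k i j, par (fr (k, i, j)) = s k)
    (hparm : ∀ k i j, par (V⁻¹ (fr (k, i, j))) = s (k - 1)) :
    IsShellCovering S s Ψ := by
  -- `Ψ ∘ relPos` is the STAR map of the transport system at the frame of the centre
  have hG : ∀ k i j (x : ℤ × ℤ × ℤ), Ψ (relPos 1 (Real.sqrt (2 / 3)) s k i j x) =
      pt ((V ^ x.1) ((J ^ (-x.2.2)) ((I ^ (-x.2.1)) (fr (k, i, j))))) := by
    intro k i j x
    rw [hshift, relPos_eq_barlowPos, hΨ]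
  refine ⟨fun q _ => hΨS q, ?_, ?_⟩
  · -- star-bijective
    intro p hp
    obtain ⟨k, i, j, rfl⟩ := hp
    have hB := hstar (fr (k, i, j))
    rw [hparm, hpar0] at hB
    rw [hΨ, contacts_barlowPos_eq_image hs]
    refine ⟨?_, ?_, ?_⟩
    · rintro _ ⟨x, hx, rfl⟩
      rw [hG]
      exact hB.1 hx
    · rintro _ ⟨x, hx, rfl⟩ _ ⟨y, hy, rfl⟩ hxy
      rw [hG, hG] at hxy
      rw [hB.2.1 hx hy hxy]
    · intro w hw
      obtain ⟨x, hx, hGx⟩ := hB.2.2 hw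
      exact ⟨relPos 1 (Real.sqrt (2 / 3)) s k i j x, ⟨x, hx, rfl⟩, by rw [hG]; exact hGx⟩
  · -- link-faithful
    intro p hp q hq q' hq'
    obtain ⟨k, i, j, rfl⟩ := hp
    rw [contacts_barlowPos_eq_image hs] at hq hq'
    obtain ⟨x, hx, rfl⟩ := hq
    obtain ⟨y, hy, rfl⟩ := hq'
    rw [Finset.mem_coe] at hx hy
    rw [dist_relPos_eq_iff_linkAdj hs one_pos sqrt_two_thirds_sq k i j
      (fst_mem_of_mem_linkOffsets hx) (fst_mem_of_mem_linkOffsets hy), hG, hG]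
    have hL := hlink (fr (k, i, j))
    rw [hparm, hpar0] at hL
    exact (hL x hx y hy).symm

/-- STUB `develop_covering` (registered skeleton stub; ALGEBRAIC half of the development): a shell
transport system on `S` yields a Hägg word `s` (the parities `s k := par (V^k f₀)` along the
vertical transport) and a shell covering `Ψ` of `S` by `idealStacking s`
(`Ψ (barlowPos 1 √(2/3) s k i j) := pt (V^k (J^j (I^i f₀)))`): into `S` since `pt` is,
star-bijective by the STAR clause read through `touching_iff_exists_linkOffsets`, link-faithful by
the LINK clause and `dist_relPos_eq_iff_linkAdj` (port of the 9227 `stub_developCovering`).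
[folklore] -/
theorem develop_covering :
    ∀ S : Set E3, TransportSystem S → ∃ s : ℤ → ℤ, IsHaggSeq s ∧ ∃ Ψ : E3 → E3, IsShellCovering S s Ψ := by
  intro S hT
  obtain ⟨F, pt, I, J, V, par, f₀, hIJ, hIV, hJV, hpt, hpar, hparI, hparJ, hstar, hlink⟩ := hT
  -- the Hägg word: parities along the vertical transport
  obtain ⟨s, hs_eq⟩ : ∃ s : ℤ → ℤ, ∀ k, s k = par ((V ^ k) f₀) := ⟨_, fun _ => rfl⟩
  have hs : IsHaggSeq s := fun k => by rw [hs_eq]; exact hpar _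
  -- the frames of the sites
  obtain ⟨fr, hfr⟩ : ∃ fr : ℤ × ℤ × ℤ → F, ∀ k i j, fr (k, i, j) = (V ^ k) ((J ^ j) ((I ^ i) f₀)) :=
    ⟨fun t => (V ^ t.1) ((J ^ t.2.2) ((I ^ t.2.1) f₀)), fun _ _ _ => rfl⟩
  -- the covering map: a site goes to the point of its frame
  have hinj := barlowPos_triple_injective one_pos
    (Real.sqrt_pos.2 (by norm_num : (0 : ℝ) < 2 / 3)) s
  obtain ⟨Ψ, hΨ, hΨS⟩ : ∃ Ψ : E3 → E3,
      (∀ k i j, Ψ (barlowPos 1 (Real.sqrt (2 / 3)) s k i j) = pt (fr (k, i, j))) ∧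
        ∀ q, Ψ q ∈ S := by
    refine ⟨fun q => pt (fr (Function.invFun
      (fun t : ℤ × ℤ × ℤ => barlowPos 1 (Real.sqrt (2 / 3)) s t.1 t.2.1 t.2.2) q)),
      fun k i j => ?_, fun q => hpt _⟩
    have h1 := Function.leftInverse_invFun hinj (k, i, j)
    simp only at h1 ⊢
    rw [h1]
  refine ⟨s, hs, Ψ, covering_isShellCovering_of_frames hs hstar hlink hΨ hΨS ?_ ?_ ?_⟩
  · -- shift rule
    intro k i j x
    rw [hfr, hfr, frame_shift hIJ hIV hJV, sub_eq_add_neg, sub_eq_add_neg]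
  · -- parity of a frame
    intro k i j
    rw [hfr, hs_eq, par_frame hIV hJV hparI hparJ]
  · -- parity of the frame below
    intro k i j
    rw [hfr, hs_eq, inv_apply_zpow_apply, par_frame hIV hJV hparI hparJ]

end Summit.AtomisticToContinuum.Crystallization.Theorems.HullExactificationCascadeRobustBarlowTemplate

end
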